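import Mathlib
import HarnessLib
import Summits.HubbardSuperconductivity.HubbardSuperconductivity.Theorems.KLProgrammeKLRegimeEngineV17F2ClosersVGQPkgI
import Summits.HubbardSuperconductivity.HubbardSuperconductivity.Theorems.KLProgrammeKLRegimeEngineV17F2ClosersVGQLadTowerG

/-!
# K3 ENGINE (stmt-HubbardSuperconductivity-20437 `KLRegimeEngineV17F2`, V2 registration 27cd7ed0f55f17c0), row (c) `stub_engine_step_values`:
# THE (c) CREDIT SHAPE `…_pkg₁₅` — row (c) VERBATIM modulo the GRID-FORM package `hexLadG` (binder #8 re-keyed on hsucc-shaped rows in grid-norms currency: k3c1-p1 g25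
# «ROW-(c)-LADSZ-MASSES» stage 3, a banked lineage level) and the (c)-OUT package ι `hexOutPkgι` (k3c2-p2 g29) UNCHANGED — ONE one-line composition
# `_pkg₁₅ hexLadG hexOutPkgι := _pkg₁₀ (rowC_hexLadPkg_of_towerGrid hexLadG) hexOutPkgι`
# (cell gate-hubbard-kl, seat hubbard-kl-k3c1-p1 g25; composes `…ClosersVGQPkgI` (`_pkg₁₀`) with `…ClosersVGQLadTowerG` (`EngineV8.rowC_hexLadPkg_of_towerGrid`))

**`A24a1G14.stub_engine_step_values_of_producers_pkg₁₅ hexLadG hexOutPkgι : <row (c) of the V2 image VERBATIM>`**.  By-type diff vs `_pkg₁₄`: binder #8 ONLY (`hexLadMP ↦ hexLadG`, the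
binder of `rowC_hexLadPkg_of_towerGrid` byte-for-byte: the kernel-sup rows replaced by hsucc's GRID rows `0 ≤ Ng`, grid kernel norms, three binomial rows); `hexOutPkgι` and the conclusion byte-identical to `_pkg₁₂`'s (texts taken mechanically from …ClosersVGQPkgIS).
A banked lineage level (the nominated v17 candidate is `_pkg₁₄`); `_pkg₉ … _pkg₁₄` stay valid readings.  Plumbing only; both packages are HYPOTHESES
(E1 / k3c2-p2 / #18 rows); nothing here asserts (c), any open row of 20437, K3, U₀, the window or superconductivity.  0 kit · 0 lit.
-/

noncomputable section

/-! ## Row (c) of the V2 image VERBATIM modulo the two ∃-packages -/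

namespace Summit.HubbardSuperconductivity.HubbardSuperconductivity.Theorems.EngineV8.A24a1G14

set_option linter.dupNamespace false -- summit = problem name (single-conjunct summit), D-0017

open Real Set Finset Complex Matrix Literature.MathematicalPhysics.QuantumLattice GrassmannAlgebra
open Literature.Probability.LatticeModels hiding torusSupNorm
open Literature.MathematicalPhysics.QuantumLattice.BandSectorCounting
open Summit.HubbardSuperconductivity.HubbardSuperconductivity.Theorems.KLProgrammeLegKernels
open Summit.HubbardSuperconductivity.HubbardSuperconductivity.Theorems.KLRegimeWick
open Summit.HubbardSuperconductivity.HubbardSuperconductivity.Theorems.TwoPointAssembly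
open Summit.HubbardSuperconductivity.HubbardSuperconductivity.Theorems.DispersionFlow
open Summit.HubbardSuperconductivity.HubbardSuperconductivity.Theorems.PerturbedFermiCurve
open Summit.HubbardSuperconductivity.HubbardSuperconductivity.Theorems.KLRegimeSplit
open Summit.HubbardSuperconductivity.HubbardSuperconductivity.Theorems.EngineV8

set_option maxHeartbeats 400000 in
/-- **THE (c) CREDIT SHAPE ON THE GRID-FORM PACKAGE WITH PACKAGE ι** — row (c) of the V2 image 27cd7ed0f55f17c0 VERBATIM modulo `hexLadG` (binder of
`EngineV8.rowC_hexLadPkg_of_towerGrid`, …ClosersVGQLadTowerG) and `hexOutPkgι` (binder of `EngineV8.rowC_hexOut_of_pkgι`, …ClosersVGQOutI).  HYPOTHESES, not assertions;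
NOT a stub credit until both packages are theorems. -/
theorem stub_engine_step_values_of_producers_pkg₁₅
    (hexLadG : ∀ (P : SplitConsts) (R : RenConsts) (c : ℝ), P.WF → R.WF2 → 0 < c → c ≤ klEngC₃7GU klEngGeo14 P R →
          ∀ μ ∈ klWindowC, ∀ U : ℝ, 0 < U → U ≤ klEngU₀12GQ klEngGeo14 (klEngQ9dG klEngGeo14 P R) P R c → ∀ β : ℝ, klBetaMin ≤ β → β ≤ Real.exp (c / U ^ 2) →
            ∀ (L M : ℕ) [NeZero L] [NeZero M], klEngL₄ P R β U ≤ L → klEngM₃ β U L ≤ M →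
              ∀ n : ℕ, 1 ≤ n → n ≤ nScales β + 1 → IsKLRegime U c (-(n : ℤ)) →
                HistP klPredsV17F2 L M klEngGeo14 P (klEngQ9dG klEngGeo14 P R) R β U μ 0 n →
                  FrameOK R U (nScales β) μ (klFlowFrameU L M β U μ n) →
                    KernelNormsV4 L M P (klEngQ9dG klEngGeo14 P R) β U μ (klFlowFrameU L M β U μ n) n →
                      (∀ j ≤ n, (KernelNormsLevels L M P (klEngQ9dG klEngGeo14 P R) β U μ (klFlowFrameU L M β U μ n) j ∧
                        KernelNormsWt4 L M (klWtBudget P (klEngQ9dG klEngGeo14 P R) U j) β U μ (klFlowFrameU L M β U μ n) j)) →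
                        (∀ j ≤ n, LevelsUExportMixedAt L M (klCU2 P R (klEngQ7 P R)) P β U μ j) →
                          (∀ j ≤ n, IsoTupleLineBAt L M klE5AM klE5cM (klE5dM P R) P β U μ j) →
                            (∀ j ≤ n, PairTransferRelFamilyK5 L M klEngGeoTh P (klCT8 P R (klEngQ7 P R) klEngGeo14 klEngGeoTh) β U μ j) →
            ∀ n' : ℕ, n = n' + 1 →
            ∃ m : ℝ, 0 ≤ m ∧ (∀ Qm s t, ‖klPairArrayF L M β U μ n' Qm s t‖ ≤ m) ∧ m * (klEngGeo14.bhi / 4) ≤ 1 / 3 ∧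
              (∀ Λ ∈ Icc (klScale klE0 (n' + 1)) (klScale klE0 n'), hubbardEffPartitionFnCT L M β U μ 0 (klFlowFrameU L M β U μ (n' + 1)) Λ ≠ 0) ∧
              ∀ (A A' : ℕ → TorusSite 2 L → ℝ → Matrix (TorusSite 2 L) (TorusSite 2 L) ℂ) (b b' : ℕ → TorusSite 2 L → ℝ → TorusSite 2 L → ℂ) (ρ : ℕ → TorusSite 2 L → TorusSite 2 L → ℝ) (V : ℕ → ℝ → (Fin 4 → HubbardFieldIdx L M) → ℂ) (V6 : ℕ → ℝ → (Fin 6 → HubbardFieldIdx L M) → ℂ) (Sg : ℕ → ℝ → FreqMomentum L M → Fin 2 → ℂ) (Hd : ℕ → ℝ → (Fin 4 → HubbardFieldIdx L M) → ℂ) (Φ : ℕ → ℝ → FreqMomentum L M → ℝ) (Wd : ℝ → FreqMomentum L M → ℝ) (Br : ℕ → TorusSite 2 L → ℝ → TorusSite 2 L × MatsubaraIdx M → ℂ),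
      (A = fun j Qm t => Matrix.of fun k k' : TorusSite 2 L => if k ∈ klBall L μ 0 ∧ k' ∈ klBall L μ 0 then vertexFn L M β (gaussConv ℂ (softCovOf L M β μ (klFlowFrameU L M β U μ (n' + 1)) (softSymbolCompl L M β μ (klFlowFrameU L M β U μ (n' + 1)) (n' + 1) j) + hubbardCovAboveCT L M β μ 0 (klFlowFrameU L M β U μ (n' + 1)) (klScale klE0 (n' + 1)) - hubbardCovAboveCT L M β μ 0 (klFlowFrameU L M β U μ (n' + 1)) (klScale klE0 n' + t * (klScale klE0 (n' + 1) - klScale klE0 n'))) (hubbardEffectiveActionCT L M β U μ 0 (klFlowFrameU L M β U μ (n' + 1)) (klScale klE0 n' + t * (klScale klE0 (n' + 1) - klScale klE0 n')))) 4 ![(((omega0 M, k'), 0), 0), ((((omega0 M).rev, Qm - k'), 1), 0), ((((omega0 M).rev, Qm - k), 1), 1), (((omega0 M, k), 0), 1)] else 0) →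
      (A' = fun j Qm t => Matrix.of fun k k' : TorusSite 2 L => if k ∈ klBall L μ 0 ∧ k' ∈ klBall L μ 0 then (klScale klE0 (n' + 1) - klScale klE0 n') • -((2 : ℂ)⁻¹ * vertexFn L M β (gaussConv ℂ (softCovOf L M β μ (klFlowFrameU L M β U μ (n' + 1)) (softSymbolCompl L M β μ (klFlowFrameU L M β U μ (n' + 1)) (n' + 1) j) + hubbardCovAboveCT L M β μ 0 (klFlowFrameU L M β U μ (n' + 1)) (klScale klE0 (n' + 1)) - hubbardCovAboveCT L M β μ 0 (klFlowFrameU L M β U μ (n' + 1)) (klScale klE0 n' + t * (klScale klE0 (n' + 1) - klScale klE0 n'))) (grassmannDerivPairing ℂ (Matrix.of fun X Y : HubbardFieldIdx L M => deriv (fun Λ'' : ℝ => hubbardCovAboveCT L M β μ 0 (klFlowFrameU L M β U μ (n' + 1)) Λ'' X Y) (klScale klE0 n' + t * (klScale klE0 (n' + 1) - klScale klE0 n'))) (hubbardEffectiveActionCT L M β U μ 0 (klFlowFrameU L M β U μ (n' + 1)) (klScale klE0 n' + t * (klScale klE0 (n' + 1) - klScale klE0 n'))) (hubbardEffectiveActionCT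 L M β U μ 0 (klFlowFrameU L M β U μ (n' + 1)) (klScale klE0 n' + t * (klScale klE0 (n' + 1) - klScale klE0 n'))))) 4 ![(((omega0 M, k'), 0), 0), ((((omega0 M).rev, Qm - k'), 1), 0), ((((omega0 M).rev, Qm - k), 1), 1), (((omega0 M, k), 0), 1)]) else 0) →
      (b = fun j Qm t p => -((klBubbleMass L M β μ (klFlowFrameU L M β U μ (n' + 1)) (fun k => (softSymbolCompl L M β μ (klFlowFrameU L M β U μ (n' + 1)) (n' + 1) j) k + (hubbardCutoffWeightCT L M β μ (klFlowFrameU L M β U μ (n' + 1)) (klScale klE0 (n' + 1)) k - hubbardCutoffWeightCT L M β μ (klFlowFrameU L M β U μ (n' + 1)) (klScale klE0 n' + t * (klScale klE0 (n' + 1) - klScale klE0 n')) k)) (fun k => (softSymbolCompl L M β μ (klFlowFrameU L M β U μ (n' + 1)) (n' + 1) j) k + (hubbardCutoffWeightCT L M β μ (klFlowFrameU L M β U μ (n' + 1)) (klScale klE0 (n' + 1)) k - hubbardCutoffWeightCT L M β μ (klFlowFrameU L M β U μ (n' + 1)) (klScale klE0 n' + t * (klScale klE0 (n' + 1) - klScale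 klE0 n')) k)) Qm p : ℝ) : ℂ)) →
      (b' = fun j Qm t p => (((klScale klE0 (n' + 1) - klScale klE0 n') * (klBubbleMass L M β μ (klFlowFrameU L M β U μ (n' + 1)) (fun k => deriv (fun Λ' => hubbardCutoffWeightCT L M β μ (klFlowFrameU L M β U μ (n' + 1)) Λ' k) (klScale klE0 n' + t * (klScale klE0 (n' + 1) - klScale klE0 n'))) (fun k => (softSymbolCompl L M β μ (klFlowFrameU L M β U μ (n' + 1)) (n' + 1) j) k + (hubbardCutoffWeightCT L M β μ (klFlowFrameU L M β U μ (n' + 1)) (klScale klE0 (n' + 1)) k - hubbardCutoffWeightCT L M β μ (klFlowFrameU L M β U μ (n' + 1)) (klScale klE0 n' + t * (klScale klE0 (n' + 1) - klScale klE0 n')) k)) Qm p + klBubbleMass L M β μ (klFlowFrameU L M β U μ (n' + 1)) (fun k => (softSymbolCompl L M β μ (klFlowFrameU L M β U μ (n' + 1)) (n' + 1) j) k + (hubbardCutoffWeightCT L M β μ (klFlowFrameU L M β U μ (n' + 1)) (klScale klE0 (n' + 1)) k - hubbardCutoffWeightCT L M β μ (klFlowFrameU L M β U μ (n' + 1)) (klScale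 klE0 n' + t * (klScale klE0 (n' + 1) - klScale klE0 n')) k)) (fun k => deriv (fun Λ' => hubbardCutoffWeightCT L M β μ (klFlowFrameU L M β U μ (n' + 1)) Λ' k) (klScale klE0 n' + t * (klScale klE0 (n' + 1) - klScale klE0 n'))) Qm p) : ℝ) : ℂ)) →
      (ρ = fun j Qm c => klRungProfile L M β μ (klFlowFrameU L M β U μ (n' + 1)) n' (softSymbolCompl L M β μ (klFlowFrameU L M β U μ (n' + 1)) (n' + 1) j) Qm c) →
      (V = fun j t X => vertexFn L M β (gaussConv ℂ (softCovOf L M β μ (klFlowFrameU L M β U μ (n' + 1)) (softSymbolCompl L M β μ (klFlowFrameU L M β U μ (n' + 1)) (n' + 1) j) + hubbardCovAboveCT L M β μ 0 (klFlowFrameU L M β U μ (n' + 1)) (klScale klE0 (n' + 1)) - hubbardCovAboveCT L M β μ 0 (klFlowFrameU L M β U μ (n' + 1)) (klScale klE0 n' + t * (klScale klE0 (n' + 1) - klScale klE0 n'))) (hubbardEffectiveActionCT L M β U μ 0 (klFlowFrameU L M β U μ (n' + 1)) (klScale klE0 n' + t * (klScale klE0 (n' + 1) - klScale klE0 n'))))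 4 X) →
      (V6 = fun j t X => vertexFn L M β (gaussConv ℂ (softCovOf L M β μ (klFlowFrameU L M β U μ (n' + 1)) (softSymbolCompl L M β μ (klFlowFrameU L M β U μ (n' + 1)) (n' + 1) j) + hubbardCovAboveCT L M β μ 0 (klFlowFrameU L M β U μ (n' + 1)) (klScale klE0 (n' + 1)) - hubbardCovAboveCT L M β μ 0 (klFlowFrameU L M β U μ (n' + 1)) (klScale klE0 n' + t * (klScale klE0 (n' + 1) - klScale klE0 n'))) (hubbardEffectiveActionCT L M β U μ 0 (klFlowFrameU L M β U μ (n' + 1)) (klScale klE0 n' + t * (klScale klE0 (n' + 1) - klScale klE0 n')))) 6 X) →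
      (Sg = fun j t p σ => selfEnergy L M β (gaussConv ℂ (softCovOf L M β μ (klFlowFrameU L M β U μ (n' + 1)) (softSymbolCompl L M β μ (klFlowFrameU L M β U μ (n' + 1)) (n' + 1) j) + hubbardCovAboveCT L M β μ 0 (klFlowFrameU L M β U μ (n' + 1)) (klScale klE0 (n' + 1)) - hubbardCovAboveCT L M β μ 0 (klFlowFrameU L M β U μ (n' + 1)) (klScale klE0 n' + t * (klScale klE0 (n' + 1) - klScale klE0 n'))) (hubbardEffectiveActionCT L M β U μ 0 (klFlowFrameU L M β U μ (n' + 1)) (klScale klE0 n' + t * (klScale klE0 (n' + 1) - klScale klE0 n')))) p σ) →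
      (Hd = fun j t X => vertexFn L M β (dblFold ℂ (grassmannLaplacian ℂ (crossCov ℂ (Matrix.of fun X Y : HubbardFieldIdx L M => deriv (fun Λ' : ℝ => hubbardCovAboveCT L M β μ 0 (klFlowFrameU L M β U μ (n' + 1)) Λ' X Y) (klScale klE0 n' + t * (klScale klE0 (n' + 1) - klScale klE0 n')))) ((gaussConv ℂ (crossCov ℂ (softCovOf L M β μ (klFlowFrameU L M β U μ (n' + 1)) (softSymbolCompl L M β μ (klFlowFrameU L M β U μ (n' + 1)) (n' + 1) j) + hubbardCovAboveCT L M β μ 0 (klFlowFrameU L M β U μ (n' + 1)) (klScale klE0 (n' + 1)) - hubbardCovAboveCT L M β μ 0 (klFlowFrameU L M β U μ (n' + 1)) (klScale klE0 n' + t * (klScale klE0 (n' + 1) - klScale klE0 n')))) - grassmannLaplacian ℂ (crossCov ℂ (softCovOf L M β μ (klFlowFrameU L M β U μ (n' + 1)) (softSymbolCompl L M β μ (klFlowFrameU L M β U μ (n' + 1)) (n' + 1) j) + hubbardCovAboveCT L M β μ 0 (klFlowFrameU L M β U μ (n' + 1)) (klScale klE0 (n' + 1)) - hubbardCovAboveCT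 L M β μ 0 (klFlowFrameU L M β U μ (n' + 1)) (klScale klE0 n' + t * (klScale klE0 (n' + 1) - klScale klE0 n'))))) (dblCopy ℂ 0 (gaussConv ℂ (softCovOf L M β μ (klFlowFrameU L M β U μ (n' + 1)) (softSymbolCompl L M β μ (klFlowFrameU L M β U μ (n' + 1)) (n' + 1) j) + hubbardCovAboveCT L M β μ 0 (klFlowFrameU L M β U μ (n' + 1)) (klScale klE0 (n' + 1)) - hubbardCovAboveCT L M β μ 0 (klFlowFrameU L M β U μ (n' + 1)) (klScale klE0 n' + t * (klScale klE0 (n' + 1) - klScale klE0 n'))) (hubbardEffectiveActionCT L M β U μ 0 (klFlowFrameU L M β U μ (n' + 1)) (klScale klE0 n' + t * (klScale klE0 (n' + 1) - klScale klE0 n')))) * dblCopy ℂ 1 (gaussConv ℂ (softCovOf L M β μ (klFlowFrameU L M β U μ (n' + 1)) (softSymbolCompl L M β μ (klFlowFrameU L M β U μ (n' + 1)) (n' + 1) j) + hubbardCovAboveCT L M β μ 0 (klFlowFrameU L M β U μ (n' + 1)) (klScale klE0 (n' + 1)) - hubbardCovAboveCT L M β μ 0 (klFlowFrameU L M β U μ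 (n' + 1)) (klScale klE0 n' + t * (klScale klE0 (n' + 1) - klScale klE0 n'))) (hubbardEffectiveActionCT L M β U μ 0 (klFlowFrameU L M β U μ (n' + 1)) (klScale klE0 n' + t * (klScale klE0 (n' + 1) - klScale klE0 n')))))))) 4 X) →
      (Φ = fun j t k => (softSymbolCompl L M β μ (klFlowFrameU L M β U μ (n' + 1)) (n' + 1) j) k + (hubbardCutoffWeightCT L M β μ (klFlowFrameU L M β U μ (n' + 1)) (klScale klE0 (n' + 1)) k - hubbardCutoffWeightCT L M β μ (klFlowFrameU L M β U μ (n' + 1)) (klScale klE0 n' + t * (klScale klE0 (n' + 1) - klScale klE0 n')) k)) →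
      (Wd = fun t k => deriv (fun Λ' : ℝ => hubbardCutoffWeightCT L M β μ (klFlowFrameU L M β U μ (n' + 1)) Λ' k) (klScale klE0 n' + t * (klScale klE0 (n' + 1) - klScale klE0 n'))) →
      (Br = fun j Qm t z => -(((((β * (L : ℝ) ^ 2 : ℝ) : ℂ)))⁻¹ * propCT L M β μ (klFlowFrameU L M β U μ (n' + 1)) (z.2, z.1) * propCT L M β μ (klFlowFrameU L M β U μ (n' + 1)) (z.2.rev, Qm - z.1)) * ((((klScale klE0 (n' + 1) - klScale klE0 n') * (-Wd t (z.2, z.1) * Φ j t (z.2.rev, Qm - z.1) - Φ j t (z.2, z.1) * Wd t (z.2.rev, Qm - z.1))) : ℝ) : ℂ)) →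
      ∀ Qm : TorusSite 2 L, IsPairClassAt L Qm (n' + 1) →
      ∃ (r' e₁ M4 M6 M2 : ℝ) (η E₁ RH RL : TorusSite 2 L → TorusSite 2 L → ℝ) (Ng : ℕ → ℝ), 0 ≤ r' ∧ 0 ≤ e₁ ∧
        -- a priori along the slice; history a priori [class #1]
        (∀ t ∈ Icc (0 : ℝ) 1, ∀ x y, ‖A (n' + 1) Qm t x y‖ ≤ m) ∧
        (∀ x y, ‖klMemberArrayF L M β U μ n' (softSymbolCompl L M β μ (klFlowFrameU L M β U μ n') n' (n' + 1)) Qm x y‖ ≤ m) ∧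
        -- (F)(i): majorant of the FRAME SHIFT `K_n → K_(n'+1)` of the history member (model objects) + its scalar cap [k3c2-p2]
        (∀ x y, ‖((Matrix.of fun k k' : TorusSite 2 L => if k ∈ klBall L μ 0 ∧ k' ∈ klBall L μ 0 then klCovSmearedPairAmplitude L M β U μ (klFlowFrameU L M β U μ (n' + 1)) n' (softCovOf L M β μ (klFlowFrameU L M β U μ (n' + 1)) (softSymbolCompl L M β μ (klFlowFrameU L M β U μ (n' + 1)) n' (n' + 1))) Qm k k' else 0) - klMemberArrayF L M β U μ n' (softSymbolCompl L M β μ (klFlowFrameU L M β U μ n') n' (n' + 1)) Qm) x y‖ ≤ η x y) ∧ (∀ x y, η x y ≤ r') ∧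
        -- smallness of the NAMED tower weight
        (3 / 2 * m + r') * ∑ p, |klSliceWeightSmeared L M β μ (klFlowFrameU L M β U μ (n' + 1)) (n' + 1) (fun _ => (0 : ℝ)) Qm p| ≤ 1 / 3 ∧
        -- class-#1 kernel inputs IN GRID-NORMS CURRENCY (hsucc's rows 48/51 at `j = n'+1`): the pinned GRID kernel norms `Ng` of `Gg(t) = effAction (SᵀC^K_(Λ(t))S)(V_N + 𝒩_(K,N))` and the
        -- three binomial numbers they produce (`γ := √6047` discharged by `klmg_isGramBoundedR_gridSub_runningSymbol`)
        (∀ m', 0 ≤ Ng m') ∧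
        (∀ t ∈ Icc (0 : ℝ) 1, ∀ m' (i : Fin (2 * m')) (w : GridLeg (GridPoint L (2 * (2 * M)))), ∑ Y ∈ univ.filter (fun Y : Fin (2 * m') → GridLeg (GridPoint L (2 * (2 * M))) => Y i = w), ‖kernel ℂ (effAction ℂ ((hubbardGridSub L M β (2 * (2 * M))).transpose * hubbardCovAboveCT L M β μ 0 (klFlowFrameU L M β U μ (n' + 1)) (klScale klE0 n' + t * (klScale klE0 (n' + 1) - klScale klE0 n')) * hubbardGridSub L M β (2 * (2 * M))) (hubbardGridInteraction L (2 * (2 * M)) β U + hubbardGridCounterQuadratic L (2 * (2 * M)) β (klFlowFrameU L M β U μ (n' + 1)))) (2 * m') Y‖ ≤ Ng m') ∧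
        (((2 * 2).factorial : ℝ) / (β * (L : ℝ) ^ 2) * (Fintype.card (GridLeg (GridPoint L (2 * (2 * M)))) * ∑ m' ∈ range (Fintype.card (GridLeg (GridPoint L (2 * (2 * M)))) / 2 + 1), if 2 ≤ m' then ((2 * m').choose (2 * 2) : ℝ) * Real.sqrt 6047 ^ (2 * m' - 2 * 2) * Ng m' else 0) ≤ M4) ∧
        (((2 * 3).factorial : ℝ) / (β * (L : ℝ) ^ 2) * (Fintype.card (GridLeg (GridPoint L (2 * (2 * M)))) * ∑ m' ∈ range (Fintype.card (GridLeg (GridPoint L (2 * (2 * M)))) / 2 + 1), if 3 ≤ m' then ((2 * m').choose (2 * 3) : ℝ) * Real.sqrt 6047 ^ (2 * m' - 2 * 3) * Ng m' else 0) ≤ M6) ∧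
        (((2 * 1).factorial : ℝ) / (β * (L : ℝ) ^ 2) * (Fintype.card (GridLeg (GridPoint L (2 * (2 * M)))) * ∑ m' ∈ range (Fintype.card (GridLeg (GridPoint L (2 * (2 * M)))) / 2 + 1), if 1 ≤ m' then ((2 * m').choose (2 * 1) : ℝ) * Real.sqrt 6047 ^ (2 * m' - 2 * 1) * Ng m' else 0) ≤ M2) ∧
        -- the «≥ 2 cross lines» class row and the localisation row (hsucc's `RH₁` / `RL₁` at `j = n'+1`)
        (∀ t ∈ Icc (0 : ℝ) 1, ∀ x y : TorusSite 2 L, ‖Hd (n' + 1) t ![(((omega0 M, y), 0), 0), ((((omega0 M).rev, Qm - y), 1), 0), ((((omega0 M).rev, Qm - x), 1), 1), (((omega0 M, x), 0), 1)]‖ ≤ RH x y) ∧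
        (∀ t ∈ Icc (0 : ℝ) 1, ∀ x y : TorusSite 2 L, ‖∑ z : TorusSite 2 L × MatsubaraIdx M, Br (n' + 1) Qm t z * ((if z.1 ∈ klBall L μ 0 then V (n' + 1) t ![(((omega0 M, z.1), 0), 0), ((((omega0 M).rev, Qm - z.1), 1), 0), ((((omega0 M).rev, Qm - x), 1), 1), (((omega0 M, x), 0), 1)] * V (n' + 1) t ![(((omega0 M, y), 0), 0), ((((omega0 M).rev, Qm - y), 1), 0), ((((omega0 M).rev, Qm - z.1), 1), 1), (((omega0 M, z.1), 0), 1)] else 0) - V (n' + 1) t ![(((z.2, z.1), 0), 0), (((z.2.rev, Qm - z.1), 1), 0), ((((omega0 M).rev, Qm - x), 1), 1), (((omega0 M, x), 0), 1)] * V (n' + 1) t ![(((omega0 M, y), 0), 0), ((((omega0 M).rev, Qm - y), 1), 0), (((z.2.rev, Qm - z.1), 1), 1), (((z.2, z.1), 0), 1)])‖ ≤ RL x y) ∧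
        -- consumer-side rows at the class-#5 bar `transferBarRelIdx … (klCT8 …) … n' n'` and the (E2-F2) slot line; the source majorant `FT_ρ[J] + FT_w[η]` is WRITTEN OUT, the member's three weight masses
        -- replaced by their MODEL envelopes («PH-PROFILE» flat core / two-shell tail, flat at `n' = 0`; born flat)
        (∀ x y, transferBarRelIdx L klEngGeoTh P (klCT8 P R (klEngQ7 P R) klEngGeo14 klEngGeoTh) β U n' n' Qm x y ≤ r') ∧
        (∀ x y, ((((klScale klE0 n' - klScale klE0 (n' + 1)) * (2⁻¹ * RH x y + ((β * (L : ℝ) ^ 2) ^ 3)⁻¹ * (M4 * M4 * ((if n' = 0 then (2048 * 15367 : ℝ) else if (4 + 8 / 3 * R.Gfr 1 * U ^ 2) * klTorusNorm L (x - y) < klScale klE0 (n' + 1) / 8 then 2048 * 15367 else 512 / 3 * (27 / (8 * Real.pi ^ 2)) * klTS * (16 / Real.pi) * (10 + 50 * (4 + 8 / 3 * R.Gfr 1 * U ^ 2) * β / L) * (16384 * (4 + 8 / 3 * R.Gfr 1 * U ^ 2) ^ 2 * min (klTorusNorm L (x - y) / klScale klE0 (n' + 1)) (klScale klE0 (n'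 + 1) / klTorusNorm L (x - y)) + Real.sqrt 2 / 4 * ((2 : ℝ) ^ n')⁻¹)) / ((klScale klE0 n' - klScale klE0 (n' + 1)) * ((β * (L : ℝ) ^ 2) ^ 3)⁻¹)) + M4 * M4 * ((if n' = 0 then (1024 * 15367 : ℝ) else if (4 + 8 / 3 * R.Gfr 1 * U ^ 2) * klTorusNorm L (x + y - Qm) < klScale klE0 (n' + 1) / 8 then 1024 * 15367 else 256 / 3 * (27 / (8 * Real.pi ^ 2)) * klTS * (16 / Real.pi) * (10 + 50 * (4 + 8 / 3 * R.Gfr 1 * U ^ 2) * β / L) * (16384 * (4 + 8 / 3 * R.Gfr 1 * U ^ 2) ^ 2 * min (klTorusNorm L (x + y - Qm) / klScale klE0 (n' + 1)) (klScale klE0 (n' + 1) / klTorusNorm L (x + y - Qm)) + Real.sqrt 2 / 4 * ((2 : ℝ) ^ n')⁻¹)) / ((klScale klE0 n' - klScale klE0 (n' + 1)) * ((β * (L : ℝ) ^ 2) ^ 3)⁻¹)) + 2 * (M6 * M2 * ((1024 * 15367 : ℝ) / ((klScale klE0 n' - klScale klE0 (n' + 1)) * ((β * (L : ℝ) ^ 2)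 ^ 3)⁻¹))))) + RL x y) + 3 / 2 * (3 / 2 * m) * ∑ c, ((klScale klE0 n' - klScale klE0 (n' + 1)) * (2⁻¹ * RH x c + ((β * (L : ℝ) ^ 2) ^ 3)⁻¹ * (M4 * M4 * ((if n' = 0 then (2048 * 15367 : ℝ) else if (4 + 8 / 3 * R.Gfr 1 * U ^ 2) * klTorusNorm L (x - c) < klScale klE0 (n' + 1) / 8 then 2048 * 15367 else 512 / 3 * (27 / (8 * Real.pi ^ 2)) * klTS * (16 / Real.pi) * (10 + 50 * (4 + 8 / 3 * R.Gfr 1 * U ^ 2) * β / L) * (16384 * (4 + 8 / 3 * R.Gfr 1 * U ^ 2) ^ 2 * min (klTorusNorm L (x - c) / klScale klE0 (n' + 1)) (klScale klE0 (n' + 1) / klTorusNorm L (x - c)) + Real.sqrt 2 / 4 * ((2 : ℝ) ^ n')⁻¹)) / ((klScale klE0 n' - klScale klE0 (n' + 1)) * ((β * (L : ℝ) ^ 2) ^ 3)⁻¹)) + M4 * M4 * ((if n' = 0 then (1024 * 15367 : ℝ) else if (4 + 8 / 3 * R.Gfr 1 * U ^ 2) * klTorusNorm L (x + c - Qm) <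 klScale klE0 (n' + 1) / 8 then 1024 * 15367 else 256 / 3 * (27 / (8 * Real.pi ^ 2)) * klTS * (16 / Real.pi) * (10 + 50 * (4 + 8 / 3 * R.Gfr 1 * U ^ 2) * β / L) * (16384 * (4 + 8 / 3 * R.Gfr 1 * U ^ 2) ^ 2 * min (klTorusNorm L (x + c - Qm) / klScale klE0 (n' + 1)) (klScale klE0 (n' + 1) / klTorusNorm L (x + c - Qm)) + Real.sqrt 2 / 4 * ((2 : ℝ) ^ n')⁻¹)) / ((klScale klE0 n' - klScale klE0 (n' + 1)) * ((β * (L : ℝ) ^ 2) ^ 3)⁻¹)) + 2 * (M6 * M2 * ((1024 * 15367 : ℝ) / ((klScale klE0 n' - klScale klE0 (n' + 1)) * ((β * (L : ℝ) ^ 2) ^ 3)⁻¹))))) + RL x c) * ρ (n' + 1) Qm c + 3 / 2 * m * ∑ a, ρ (n' + 1) Qm a * ((klScale klE0 n' - klScale klE0 (n' + 1)) * (2⁻¹ * RH a y + ((β * (L : ℝ) ^ 2) ^ 3)⁻¹ * (M4 * M4 * ((if n' = 0 then (2048 * 15367 : ℝ) else if (4 + 8 / 3 * R.Gfr 1 *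 U ^ 2) * klTorusNorm L (a - y) < klScale klE0 (n' + 1) / 8 then 2048 * 15367 else 512 / 3 * (27 / (8 * Real.pi ^ 2)) * klTS * (16 / Real.pi) * (10 + 50 * (4 + 8 / 3 * R.Gfr 1 * U ^ 2) * β / L) * (16384 * (4 + 8 / 3 * R.Gfr 1 * U ^ 2) ^ 2 * min (klTorusNorm L (a - y) / klScale klE0 (n' + 1)) (klScale klE0 (n' + 1) / klTorusNorm L (a - y)) + Real.sqrt 2 / 4 * ((2 : ℝ) ^ n')⁻¹)) / ((klScale klE0 n' - klScale klE0 (n' + 1)) * ((β * (L : ℝ) ^ 2) ^ 3)⁻¹)) + M4 * M4 * ((if n' = 0 then (1024 * 15367 : ℝ) else if (4 + 8 / 3 * R.Gfr 1 * U ^ 2) * klTorusNorm L (a + y - Qm) < klScale klE0 (n' + 1) / 8 then 1024 * 15367 else 256 / 3 * (27 / (8 * Real.pi ^ 2)) * klTS * (16 / Real.pi) * (10 + 50 * (4 + 8 / 3 * R.Gfr 1 * U ^ 2) * β / L) * (16384 * (4 + 8 / 3 * R.Gfr 1 * U ^ 2) ^ 2 * min (klTorusNorm L (a + y - Qm) /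 klScale klE0 (n' + 1)) (klScale klE0 (n' + 1) / klTorusNorm L (a + y - Qm)) + Real.sqrt 2 / 4 * ((2 : ℝ) ^ n')⁻¹)) / ((klScale klE0 n' - klScale klE0 (n' + 1)) * ((β * (L : ℝ) ^ 2) ^ 3)⁻¹)) + 2 * (M6 * M2 * ((1024 * 15367 : ℝ) / ((klScale klE0 n' - klScale klE0 (n' + 1)) * ((β * (L : ℝ) ^ 2) ^ 3)⁻¹))))) + RL a y) + 9 / 4 * m * (3 / 2 * m) * ∑ a, ∑ c, ρ (n' + 1) Qm a * ((klScale klE0 n' - klScale klE0 (n' + 1)) * (2⁻¹ * RH a c + ((β * (L : ℝ) ^ 2) ^ 3)⁻¹ * (M4 * M4 * ((if n' = 0 then (2048 * 15367 : ℝ) else if (4 + 8 / 3 * R.Gfr 1 * U ^ 2) * klTorusNorm L (a - c) < klScale klE0 (n' + 1) / 8 then 2048 * 15367 else 512 / 3 * (27 / (8 * Real.pi ^ 2)) * klTS * (16 / Real.pi) * (10 + 50 * (4 + 8 / 3 * R.Gfr 1 * U ^ 2) * β / L) * (16384 * (4 + 8 / 3 * R.Gfr 1 * U ^ 2) ^ 2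 * min (klTorusNorm L (a - c) / klScale klE0 (n' + 1)) (klScale klE0 (n' + 1) / klTorusNorm L (a - c)) + Real.sqrt 2 / 4 * ((2 : ℝ) ^ n')⁻¹)) / ((klScale klE0 n' - klScale klE0 (n' + 1)) * ((β * (L : ℝ) ^ 2) ^ 3)⁻¹)) + M4 * M4 * ((if n' = 0 then (1024 * 15367 : ℝ) else if (4 + 8 / 3 * R.Gfr 1 * U ^ 2) * klTorusNorm L (a + c - Qm) < klScale klE0 (n' + 1) / 8 then 1024 * 15367 else 256 / 3 * (27 / (8 * Real.pi ^ 2)) * klTS * (16 / Real.pi) * (10 + 50 * (4 + 8 / 3 * R.Gfr 1 * U ^ 2) * β / L) * (16384 * (4 + 8 / 3 * R.Gfr 1 * U ^ 2) ^ 2 * min (klTorusNorm L (a + c - Qm) / klScale klE0 (n' + 1)) (klScale klE0 (n' + 1) / klTorusNorm L (a + c - Qm)) + Real.sqrt 2 / 4 * ((2 : ℝ) ^ n')⁻¹)) / ((klScale klE0 n' - klScale klE0 (n' + 1)) * ((β * (L : ℝ) ^ 2) ^ 3)⁻¹)) + 2 * (M6 * M2 * ((1024 * 15367 : ℝ) /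 ((klScale klE0 n' - klScale klE0 (n' + 1)) * ((β * (L : ℝ) ^ 2) ^ 3)⁻¹))))) + RL a c) * ρ (n' + 1) Qm c) +
            (η x y + 3 / 2 * (3 / 2 * m) * ∑ t, η x t * |klSliceWeightSmeared L M β μ (klFlowFrameU L M β U μ (n' + 1)) (n' + 1) (fun _ => (0 : ℝ)) Qm t| + 3 / 2 * (3 / 2 * m + r') * ∑ a, |klSliceWeightSmeared L M β μ (klFlowFrameU L M β U μ (n' + 1)) (n' + 1) (fun _ => (0 : ℝ)) Qm a| * η a y + 9 / 4 * (3 / 2 * m + r') * (3 / 2 * m) * ∑ a, ∑ t, |klSliceWeightSmeared L M β μ (klFlowFrameU L M β U μ (n' + 1)) (n' + 1) (fun _ => (0 : ℝ)) Qm a| * η a t * |klSliceWeightSmeared L M β μ (klFlowFrameU L M β U μ (n' + 1)) (n' + 1) (fun _ => (0 : ℝ)) Qm t|)) +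
          (transferBarRelIdx L klEngGeoTh P (klCT8 P R (klEngQ7 P R) klEngGeo14 klEngGeoTh) β U n' n' Qm x y + 3 / 2 * (3 / 2 * m) * ∑ t, transferBarRelIdx L klEngGeoTh P (klCT8 P R (klEngQ7 P R) klEngGeo14 klEngGeoTh) β U n' n' Qm x t * |klSliceWeightSmeared L M β μ (klFlowFrameU L M β U μ (n' + 1)) (n' + 1) (fun _ => (0 : ℝ)) Qm t| + 3 / 2 * (3 / 2 * m + r') * ∑ a, |klSliceWeightSmeared L M β μ (klFlowFrameU L M β U μ (n' + 1)) (n' + 1) (fun _ => (0 : ℝ)) Qm a| * transferBarRelIdx L klEngGeoTh P (klCT8 P R (klEngQ7 P R) klEngGeo14 klEngGeoTh) β U n' n' Qm a y + 9 / 4 * (3 / 2 * m + r') * (3 / 2 * m) * ∑ a, ∑ t, |klSliceWeightSmeared L M β μ (klFlowFrameU L M β U μ (n' + 1)) (n' + 1) (fun _ => (0 : ℝ)) Qm a| * transferBarRelIdx L klEngGeoTh P (klCT8 P R (klEngQ7 P R) klEngGeo14 klEngGeoTh) β U n' n' Qm a t * |klSliceWeightSmeared L M β μ (klFlowFrameU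 L M β U μ (n' + 1)) (n' + 1) (fun _ => (0 : ℝ)) Qm t|) ≤ E₁ x y) ∧
        (∀ x y, E₁ x y ≤ e₁) ∧
        (∀ k ∈ klBall L μ 0, ∀ k' ∈ klBall L μ 0, E₁ k k' ≤ drivePBar klEngGeo14 P U n' + eremBar klEngGeo14 P (klEngQ9dG klEngGeo14 P R) U β L n' + thermalBar klEngGeo14 P U β (n' + 1) +
              legDressBarQ2 klEngGeo14 P (klEngQ9dG klEngGeo14 P R) U (n' + 1) (legSliceCountT L β μ (klFlowFrameU L M β U μ (n' + 1)) (n' + 1) ![k', Qm - k', Qm - k, k]) +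
              (P.Klam * U) ^ 2 * (klEngGeo14.phGain (n' + 1) (klTorusNorm L (k - k')) + klEngGeo14.phGain (n' + 1) (klTorusNorm L (k + k' - Qm))) +
              frameShiftBar P (klEngQ9dG klEngGeo14 P R) U (n' + 1)))
    (hexOutPkg :
      ∀ (P : SplitConsts) (R : RenConsts) (c : ℝ), P.WF → R.WF2 → 0 < c → c ≤ klEngC₃7GU klEngGeo14 P R →
        ∀ μ ∈ klWindowC, ∀ U : ℝ, 0 < U → U ≤ klEngU₀12GQ klEngGeo14 (klEngQ9dG klEngGeo14 P R) P R c → ∀ β : ℝ, klBetaMin ≤ β → β ≤ Real.exp (c / U ^ 2) →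
          ∀ (L M : ℕ) [NeZero L] [NeZero M], klEngL₄ P R β U ≤ L → klEngM₃ β U L ≤ M →
            ∀ n' : ℕ, 1 ≤ n' → n' ≤ nScales β + 1 → IsKLRegime U c (-(n' : ℤ)) →
              HistP klPredsV17F2 L M klEngGeo14 P (klEngQ9dG klEngGeo14 P R) R β U μ 0 n' →
                FrameOK R U (nScales β) μ (klFlowFrameU L M β U μ n') →
                  KernelNormsV4 L M P (klEngQ9dG klEngGeo14 P R) β U μ (klFlowFrameU L M β U μ n') n' →
                    (∀ j ≤ n', (KernelNormsLevels L M P (klEngQ9dG klEngGeo14 P R) β U μ (klFlowFrameU L M β U μ n') j ∧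
                      KernelNormsWt4 L M (klWtBudget P (klEngQ9dG klEngGeo14 P R) U j) β U μ (klFlowFrameU L M β U μ n') j)) →
                      (∀ j ≤ n', LevelsUExportMixedAt L M (klCU2 P R (klEngQ7 P R)) P β U μ j) →
                        (∀ j ≤ n', IsoTupleLineBAt L M klE5AM klE5cM (klE5dM P R) P β U μ j) →
                          (∀ j ≤ n', PairTransferRelFamilyK5 L M klEngGeoTh P (klCT8 P R (klEngQ7 P R) klEngGeo14 klEngGeoTh) β U μ j) →
          ∀ n : ℕ, n' = n + 1 → ∀ Qm : TorusSite 2 L, ¬ IsPairClassAt L Qm (n + 1) → ∀ x ∈ klBall L μ 0, ∀ y ∈ klBall L μ 0,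
            ∀ j : ℕ, j = n + 1 →
            ∀ (A A' : ℕ → TorusSite 2 L → ℝ → Matrix (TorusSite 2 L) (TorusSite 2 L) ℂ) (b' : ℕ → TorusSite 2 L → ℝ → TorusSite 2 L → ℂ),
              (A = fun j Qm t => Matrix.of fun k k' : TorusSite 2 L => if k ∈ klBall L μ 0 ∧ k' ∈ klBall L μ 0 then vertexFn L M β (gaussConv ℂ (softCovOf L M β μ (klFlowFrameU L M β U μ n) (softSymbolCompl L M β μ (klFlowFrameU L M β U μ n) (n + 1) j) + hubbardCovAboveCT L M β μ 0 (klFlowFrameU L M β U μ n) (klScale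
                  klE0 (n + 1)) - hubbardCovAboveCT L M β μ 0 (klFlowFrameU L M β U μ n) (klScale klE0 n + t * (klScale klE0 (n + 1) - klScale klE0 n))) (hubbardEffectiveActionCT L M β U μ 0 (klFlowFrameU L M β U μ n) (klScale klE0 n + t * (klScale klE0 (n + 1) - klScale klE0 n)))) 4 ![(((omega0 M, k'), 0), 0),
                  ((((omega0 M).rev, Qm - k'), 1), 0), ((((omega0 M).rev, Qm - k), 1), 1), (((omega0 M, k), 0), 1)] else 0) →
              (A' = fun j Qm t => Matrix.of fun k k' : TorusSite 2 L => if k ∈ klBall L μ 0 ∧ k' ∈ klBall L μ 0 then (klScale klE0 (n + 1) - klScale klE0 n) • -((2 : ℂ)⁻¹ * vertexFn L M β (gaussConv ℂ (softCovOf L M β μ (klFlowFrameU L M β U μ n) (softSymbolCompl L M β μ (klFlowFrameU L M β U μ n) (n + 1) j) +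
                  hubbardCovAboveCT L M β μ 0 (klFlowFrameU L M β U μ n) (klScale klE0 (n + 1)) - hubbardCovAboveCT L M β μ 0 (klFlowFrameU L M β U μ n) (klScale klE0 n + t * (klScale klE0 (n + 1) - klScale klE0 n))) (grassmannDerivPairing ℂ (Matrix.of fun X Y : HubbardFieldIdx L M => deriv (fun Λ'' : ℝ =>
                  hubbardCovAboveCT L M β μ 0 (klFlowFrameU L M β U μ n) Λ'' X Y) (klScale klE0 n + t * (klScale klE0 (n + 1) - klScale klE0 n))) (hubbardEffectiveActionCT L M β U μ 0 (klFlowFrameU L M β U μ n) (klScale klE0 n + t * (klScale klE0 (n + 1) - klScale klE0 n))) (hubbardEffectiveActionCT L M β U μ 0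
                  (klFlowFrameU L M β U μ n) (klScale klE0 n + t * (klScale klE0 (n + 1) - klScale klE0 n))))) 4 ![(((omega0 M, k'), 0), 0), ((((omega0 M).rev, Qm - k'), 1), 0), ((((omega0 M).rev, Qm - k), 1), 1), (((omega0 M, k), 0), 1)]) else 0) →
              (b' = fun (j : ℕ) (Qm : TorusSite 2 L) (t : ℝ) (p : TorusSite 2 L) => (((klScale klE0 (n + 1) - klScale klE0 n) * (klBubbleMass L M β μ (klFlowFrameU L M β U μ n) (fun k => deriv (fun Λ' => hubbardCutoffWeightCT L M β μ (klFlowFrameU L M β U μ n) Λ' k) (klScale klE0 n + t * (klScale klE0 (n + 1) -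
                  klScale klE0 n))) (fun k => (softSymbolCompl L M β μ (klFlowFrameU L M β U μ n) (n + 1) j) k + (hubbardCutoffWeightCT L M β μ (klFlowFrameU L M β U μ n) (klScale klE0 (n + 1)) k - hubbardCutoffWeightCT L M β μ (klFlowFrameU L M β U μ n) (klScale klE0 n + t * (klScale klE0 (n + 1) - klScale klE0 n))
                  k)) Qm p + klBubbleMass L M β μ (klFlowFrameU L M β U μ n) (fun k => (softSymbolCompl L M β μ (klFlowFrameU L M β U μ n) (n + 1) j) k + (hubbardCutoffWeightCT L M β μ (klFlowFrameU L M β U μ n) (klScale klE0 (n + 1)) k - hubbardCutoffWeightCT L M β μ (klFlowFrameU L M β U μ n) (klScale klE0 n + t *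
                  (klScale klE0 (n + 1) - klScale klE0 n)) k)) (fun k => deriv (fun Λ' => hubbardCutoffWeightCT L M β μ (klFlowFrameU L M β U μ n) Λ' k) (klScale klE0 n + t * (klScale klE0 (n + 1) - klScale klE0 n))) Qm p) : ℝ) : ℂ)) →
            ∀ (V : ℕ → ℝ → (Fin 4 → HubbardFieldIdx L M) → ℂ), (V = fun j t X => vertexFn L M β (gaussConv ℂ (softCovOf L M β μ (klFlowFrameU L M β U μ n) (softSymbolCompl L M β μ (klFlowFrameU L M β U μ n) (n + 1) j) + hubbardCovAboveCT L M β μ 0 (klFlowFrameU L M β U μ n) (klScale klE0 (n + 1)) - hubbardCovAboveCT L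
                M β μ 0 (klFlowFrameU L M β U μ n) (klScale klE0 n + t * (klScale klE0 (n + 1) - klScale klE0 n))) (hubbardEffectiveActionCT L M β U μ 0 (klFlowFrameU L M β U μ n) (klScale klE0 n + t * (klScale klE0 (n + 1) - klScale klE0 n)))) 4 X) →
            ∀ (V6 : ℕ → ℝ → (Fin 6 → HubbardFieldIdx L M) → ℂ), (V6 = fun j t X => vertexFn L M β (gaussConv ℂ (softCovOf L M β μ (klFlowFrameU L M β U μ n) (softSymbolCompl L M β μ (klFlowFrameU L M β U μ n) (n + 1) j) + hubbardCovAboveCT L M β μ 0 (klFlowFrameU L M β U μ n) (klScale klE0 (n + 1)) - hubbardCovAboveCT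
                L M β μ 0 (klFlowFrameU L M β U μ n) (klScale klE0 n + t * (klScale klE0 (n + 1) - klScale klE0 n))) (hubbardEffectiveActionCT L M β U μ 0 (klFlowFrameU L M β U μ n) (klScale klE0 n + t * (klScale klE0 (n + 1) - klScale klE0 n)))) 6 X) →
            ∀ (Sg : ℕ → ℝ → FreqMomentum L M → Fin 2 → ℂ), (Sg = fun j t p σ => selfEnergy L M β (gaussConv ℂ (softCovOf L M β μ (klFlowFrameU L M β U μ n) (softSymbolCompl L M β μ (klFlowFrameU L M β U μ n) (n + 1) j) + hubbardCovAboveCT L M β μ 0 (klFlowFrameU L M β U μ n) (klScale klE0 (n + 1)) - hubbardCovAboveCT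
                L M β μ 0 (klFlowFrameU L M β U μ n) (klScale klE0 n + t * (klScale klE0 (n + 1) - klScale klE0 n))) (hubbardEffectiveActionCT L M β U μ 0 (klFlowFrameU L M β U μ n) (klScale klE0 n + t * (klScale klE0 (n + 1) - klScale klE0 n)))) p σ) →
            ∀ (Hd : ℕ → ℝ → (Fin 4 → HubbardFieldIdx L M) → ℂ), (Hd = fun j t X => vertexFn L M β (dblFold ℂ (grassmannLaplacian ℂ (crossCov ℂ (Matrix.of fun X Y : HubbardFieldIdx L M => deriv (fun Λ' : ℝ => hubbardCovAboveCT L M β μ 0 (klFlowFrameU L M β U μ n) Λ' X Y) (klScale klE0 n + t * (klScale klE0 (n + 1) -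
                klScale klE0 n)))) ((gaussConv ℂ (crossCov ℂ (softCovOf L M β μ (klFlowFrameU L M β U μ n) (softSymbolCompl L M β μ (klFlowFrameU L M β U μ n) (n + 1) j) + hubbardCovAboveCT L M β μ 0 (klFlowFrameU L M β U μ n) (klScale klE0 (n + 1)) - hubbardCovAboveCT L M β μ 0 (klFlowFrameU L M β U μ n) (klScale
                klE0 n + t * (klScale klE0 (n + 1) - klScale klE0 n)))) - grassmannLaplacian ℂ (crossCov ℂ (softCovOf L M β μ (klFlowFrameU L M β U μ n) (softSymbolCompl L M β μ (klFlowFrameU L M β U μ n) (n + 1) j) + hubbardCovAboveCT L M β μ 0 (klFlowFrameU L M β U μ n) (klScale klE0 (n + 1)) - hubbardCovAboveCT L M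
                β μ 0 (klFlowFrameU L M β U μ n) (klScale klE0 n + t * (klScale klE0 (n + 1) - klScale klE0 n))))) (dblCopy ℂ 0 (gaussConv ℂ (softCovOf L M β μ (klFlowFrameU L M β U μ n) (softSymbolCompl L M β μ (klFlowFrameU L M β U μ n) (n + 1) j) + hubbardCovAboveCT L M β μ 0 (klFlowFrameU L M β U μ n) (klScale
                klE0 (n + 1)) - hubbardCovAboveCT L M β μ 0 (klFlowFrameU L M β U μ n) (klScale klE0 n + t * (klScale klE0 (n + 1) - klScale klE0 n))) (hubbardEffectiveActionCT L M β U μ 0 (klFlowFrameU L M β U μ n) (klScale klE0 n + t * (klScale klE0 (n + 1) - klScale klE0 n)))) * dblCopy ℂ 1 (gaussConv ℂ (softCovOf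
                L M β μ (klFlowFrameU L M β U μ n) (softSymbolCompl L M β μ (klFlowFrameU L M β U μ n) (n + 1) j) + hubbardCovAboveCT L M β μ 0 (klFlowFrameU L M β U μ n) (klScale klE0 (n + 1)) - hubbardCovAboveCT L M β μ 0 (klFlowFrameU L M β U μ n) (klScale klE0 n + t * (klScale klE0 (n + 1) - klScale klE0 n)))
                (hubbardEffectiveActionCT L M β U μ 0 (klFlowFrameU L M β U μ n) (klScale klE0 n + t * (klScale klE0 (n + 1) - klScale klE0 n)))))))) 4 X) →
            ∀ (Φ : ℕ → ℝ → FreqMomentum L M → ℝ), (Φ = fun j t k => (softSymbolCompl L M β μ (klFlowFrameU L M β U μ n) (n + 1) j) k + (hubbardCutoffWeightCT L M β μ (klFlowFrameU L M β U μ n) (klScale klE0 (n + 1)) k - hubbardCutoffWeightCT L M β μ (klFlowFrameU L M β U μ n) (klScale klE0 n + t * (klScale klE0 (n +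
                1) - klScale klE0 n)) k)) →
            ∀ (Wd : ℝ → FreqMomentum L M → ℝ), (Wd = fun t k => deriv (fun Λ' : ℝ => hubbardCutoffWeightCT L M β μ (klFlowFrameU L M β U μ n) Λ' k) (klScale klE0 n + t * (klScale klE0 (n + 1) - klScale klE0 n))) →
            ∀ (Br : ℕ → TorusSite 2 L → ℝ → TorusSite 2 L × MatsubaraIdx M → ℂ), (Br = fun j Qm t z => -(((((β * (L : ℝ) ^ 2 : ℝ) : ℂ)))⁻¹ * propCT L M β μ (klFlowFrameU L M β U μ n) (z.2, z.1) * propCT L M β μ (klFlowFrameU L M β U μ n) (z.2.rev, Qm - z.1)) * ((((klScale klE0 (n + 1) - klScale klE0 n) * (-Wd t (z.2,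
                z.1) * Φ j t (z.2.rev, Qm - z.1) - Φ j t (z.2, z.1) * Wd t (z.2.rev, Qm - z.1))) : ℝ) : ℂ)) →
            ∃ (c₄ RH : ℝ) (A₁ Kg ε₁ : ℝ) (Nc : ℕ) (S : Fin Nc → Finset (TorusSite 2 L)) (αc βc Lc : Fin Nc → ℝ) (r : ℝ) (Nw : ℕ) (cen cenx cenL : Fin Nw → TorusSite 2 L) (ρw A₂ : Fin Nw → ℝ) (A₀S LAS εS : ℝ),
              (∀ Λ ∈ Icc (klScale klE0 (n + 1)) (klScale klE0 n), hubbardEffPartitionFnCT L M β U μ 0 (klFlowFrameU L M β U μ n) Λ ≠ 0) ∧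
              (∀ t ∈ Icc (0 : ℝ) 1, ∀ X, ‖V j t X‖ ≤ c₄ * U) ∧
              c₄ ^ 2 ≤ 2 ^ 3 * P.Klam ^ 2 ∧
              (∀ t ∈ Icc (0 : ℝ) 1, ‖Hd j t ![(((omega0 M, y), 0), 0), ((((omega0 M).rev, Qm - y), 1), 0), ((((omega0 M).rev, Qm - x), 1), 1), (((omega0 M, x), 0), 1)]‖ ≤ RH) ∧
              (∀ t ∈ Icc (0 : ℝ) 1, ∀ z : TorusSite 2 L × MatsubaraIdx M, z.1 ∈ klBall L μ 0 → matsubaraFreq β M z.2 ^ 2 ≤ (4 * klScale klE0 (n + 1)) ^ 2 →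
                ‖V j t ![(((omega0 M, z.1), 0), 0), ((((omega0 M).rev, Qm - z.1), 1), 0), ((((omega0 M).rev, Qm - x), 1), 1), (((omega0 M, x), 0), 1)] *
                    V j t ![(((omega0 M, y), 0), 0), ((((omega0 M).rev, Qm - y), 1), 0), ((((omega0 M).rev, Qm - z.1), 1), 1), (((omega0 M, z.1), 0), 1)] -
                  V j t ![(((z.2, z.1), 0), 0), (((z.2.rev, Qm - z.1), 1), 0), ((((omega0 M).rev, Qm - x), 1), 1), (((omega0 M, x), 0), 1)] *
                    V j t ![(((omega0 M, y), 0), 0), ((((omega0 M).rev, Qm - y), 1), 0), (((z.2.rev, Qm - z.1), 1), 1), (((z.2, z.1), 0), 1)]‖ ≤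
                  ε₁ + ∑ w, (if klTorusNorm L (z.1 - cenL w) ≤ ρw w then A₂ w else 0)) ∧
              (0 ≤ A₁) ∧
              (0 ≤ Kg) ∧
              (0 ≤ ε₁) ∧
              (∀ t ∈ Icc (0 : ℝ) 1, ∀ k : TorusSite 2 L, ‖∑ σ : Fin 2, V j t ![(((omega0 M, k), σ), 1), (((omega0 M, k + (x - y)), σ), 0), (((omega0 M, y), 0), 0), (((omega0 M, x), 0), 1)] * V j t ![(((omega0 M, k), σ), 0), (((omega0 M, k + (x - y)), σ), 1), ((((omega0 M).rev, Qm - y), 1), 0), ((((omega0 M).rev, Qm - x), 1), 1)]‖ ≤ A₁) ∧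
              (∀ t ∈ Icc (0 : ℝ) 1, ∀ k k' : TorusSite 2 L, ‖(∑ σ : Fin 2, V j t ![(((omega0 M, k), σ), 1), (((omega0 M, k + (x - y)), σ), 0), (((omega0 M, y), 0), 0), (((omega0 M, x), 0), 1)] * V j t ![(((omega0 M, k), σ), 0), (((omega0 M, k + (x - y)), σ), 1), ((((omega0 M).rev, Qm - y), 1), 0), ((((omega0 M).rev, Qm - x), 1), 1)]) - ∑ σ : Fin 2, V j t ![(((omega0 M, k'), σ), 1), (((omega0 M, k' + (x - y)), σ), 0), (((omega0 M, y), 0), 0), (((omega0 M, x), 0), 1)] * V j t ![(((omega0 M, k'), σ), 0), (((omega0 M, k' + (x - y)), σ), 1), ((((omega0 M).rev, Qm - y), 1), 0), ((((omega0 M).rev, Qm - x), 1), 1)]‖ ≤ Kg * klTorusNorm L (k - k')) ∧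
              (∀ t ∈ Icc (0 : ℝ) 1, ∀ k : TorusSite 2 L, ‖∑ σ : Fin 2, V j t ![(((omega0 M, k + -(x - y)), σ), 1), (((omega0 M, k), σ), 0), (((omega0 M, y), 0), 0), (((omega0 M, x), 0), 1)] * V j t ![(((omega0 M, k + -(x - y)), σ), 0), (((omega0 M, k), σ), 1), ((((omega0 M).rev, Qm - y), 1), 0), ((((omega0 M).rev, Qm - x), 1), 1)]‖ ≤ A₁) ∧
              (∀ t ∈ Icc (0 : ℝ) 1, ∀ k k' : TorusSite 2 L, ‖(∑ σ : Fin 2, V j t ![(((omega0 M, k + -(x - y)), σ), 1), (((omega0 M, k), σ), 0), (((omega0 M, y), 0), 0), (((omega0 M, x), 0), 1)] * V j t ![(((omega0 M, k + -(x - y)), σ), 0), (((omega0 M, k), σ), 1), ((((omega0 M).rev, Qm - y), 1), 0), ((((omega0 M).rev, Qm - x), 1), 1)]) - ∑ σ : Fin 2, V j t ![(((omega0 M, k' + -(x - y)), σ), 1), (((omega0 M, k'), σ), 0), (((omega0 M, y), 0), 0), (((omega0 M, x), 0), 1)] * V j t ![(((omega0 M, k' + -(x - y)), σ), 0), (((omega0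 M, k'), σ), 1), ((((omega0 M).rev, Qm - y), 1), 0), ((((omega0 M).rev, Qm - x), 1), 1)]‖ ≤ Kg * klTorusNorm L (k - k')) ∧
              (∀ t ∈ Icc (0 : ℝ) 1, ∀ (i : MatsubaraIdx M) (σ : Fin 2) (k k' : TorusSite 2 L), matsubaraFreq β M i ^ 2 ≤ (4 * klScale klE0 (n + 1)) ^ 2 → (∀ w, ρw w < klTorusNorm L (k - cen w)) → ‖V j t ![(((i, k), σ), 1), (((i, k'), σ), 0), (((omega0 M, y), 0), 0), (((omega0 M, x), 0), 1)] * V j t ![(((i, k), σ), 0), (((i, k'), σ), 1), ((((omega0 M).rev, Qm - y), 1), 0), ((((omega0 M).rev, Qm - x), 1), 1)] - V j t ![(((omega0 M, k), σ), 1), (((omega0 M, k'), σ), 0), (((omega0 M, y), 0), 0), (((omega0 M, x), 0), 1)] * V j t ![(((omega0 M, k), σ), 0), (((omega0 M, k'), σ), 1), ((((omega0 M).rev, Qm - y), 1), 0), ((((omega0 M).rev, Qm - x), 1), 1)]‖ ≤ ε₁) ∧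
              (∀ t ∈ Icc (0 : ℝ) 1, ∀ k : TorusSite 2 L, ‖V j t ![(((omega0 M, k), 0), 1), ((((omega0 M).rev, k + (Qm - x - y)), 1), 0), (((omega0 M, y), 0), 0), ((((omega0 M).rev, Qm - x), 1), 1)] * V j t ![(((omega0 M, k), 0), 0), ((((omega0 M).rev, k + (Qm - x - y)), 1), 1), ((((omega0 M).rev, Qm - y), 1), 0), (((omega0 M, x), 0), 1)]‖ ≤ A₁) ∧
              (∀ t ∈ Icc (0 : ℝ) 1, ∀ k k' : TorusSite 2 L, ‖V j t ![(((omega0 M, k), 0), 1), ((((omega0 M).rev, k + (Qm - x - y)), 1), 0), (((omega0 M, y), 0), 0), ((((omega0 M).rev, Qm - x), 1), 1)] * V j t ![(((omega0 M, k), 0), 0), ((((omega0 M).rev, k + (Qm - x - y)), 1), 1), ((((omega0 M).rev, Qm - y), 1), 0), (((omega0 M, x), 0), 1)] - V j t ![(((omega0 M, k'), 0), 1), ((((omega0 M).rev, k' + (Qm - x - y)), 1), 0), (((omega0 M, y), 0), 0), ((((omega0 M).rev, Qm - x), 1), 1)] * V j t ![(((omega0 M, k'), 0), 0), ((((omega0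 M).rev, k' + (Qm - x - y)), 1), 1), ((((omega0 M).rev, Qm - y), 1), 0), (((omega0 M, x), 0), 1)]‖ ≤ Kg * klTorusNorm L (k - k')) ∧
              (∀ t ∈ Icc (0 : ℝ) 1, ∀ k : TorusSite 2 L, ‖V j t ![(((omega0 M, k + -(Qm - x - y)), 0), 1), ((((omega0 M).rev, k), 1), 0), (((omega0 M, y), 0), 0), ((((omega0 M).rev, Qm - x), 1), 1)] * V j t ![(((omega0 M, k + -(Qm - x - y)), 0), 0), ((((omega0 M).rev, k), 1), 1), ((((omega0 M).rev, Qm - y), 1), 0), (((omega0 M, x), 0), 1)]‖ ≤ A₁) ∧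
              (∀ t ∈ Icc (0 : ℝ) 1, ∀ k k' : TorusSite 2 L, ‖V j t ![(((omega0 M, k + -(Qm - x - y)), 0), 1), ((((omega0 M).rev, k), 1), 0), (((omega0 M, y), 0), 0), ((((omega0 M).rev, Qm - x), 1), 1)] * V j t ![(((omega0 M, k + -(Qm - x - y)), 0), 0), ((((omega0 M).rev, k), 1), 1), ((((omega0 M).rev, Qm - y), 1), 0), (((omega0 M, x), 0), 1)] - V j t ![(((omega0 M, k' + -(Qm - x - y)), 0), 1), ((((omega0 M).rev, k'), 1), 0), (((omega0 M, y), 0), 0), ((((omega0 M).rev, Qm - x), 1), 1)] * V j t ![(((omega0 M, k' + -(Qm - x - y)), 0), 0), ((((omega0 M).rev, k'), 1), 1), ((((omega0 M).rev, Qm - y), 1), 0), (((omega0 M, x), 0), 1)]‖ ≤ Kg * klTorusNorm L (k - k')) ∧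
              (∀ t ∈ Icc (0 : ℝ) 1, ∀ (i i' : MatsubaraIdx M) (k k' : TorusSite 2 L), matsubaraInt M i' + 1 = matsubaraInt M i → matsubaraFreq β M i ^ 2 ≤ (5 * klScale klE0 (n + 1)) ^ 2 → (∀ w, ρw w < klTorusNorm L (k - cenx w)) → ‖V j t ![(((i, k), 0), 1), (((i', k'), 1), 0), (((omega0 M, y), 0), 0), ((((omega0 M).rev, Qm - x), 1), 1)] * V j t ![(((i, k), 0), 0), (((i', k'), 1), 1), ((((omega0 M).rev, Qm - y), 1), 0), (((omega0 M, x), 0), 1)] - V j t ![(((omega0 M, k), 0), 1), ((((omega0 M).rev, k'), 1), 0), (((omega0 M, y), 0), 0), ((((omega0 M).rev, Qm - x), 1), 1)] * V j t ![(((omega0 M, k), 0), 0), ((((omega0 M).rev, k'), 1), 1), ((((omega0 M).rev, Qm - y), 1), 0), (((omega0 M, x), 0), 1)]‖ ≤ ε₁) ∧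
              (∀ i, αc i ≤ βc i) ∧
              (∀ i, 0 ≤ Lc i) ∧
              (100 / 7 * klScale klE0 (n + 1) + Real.pi / L ≤ r) ∧
              (∀ i, ∀ θ ∈ Icc (αc i) (βc i), ∀ k : TorusSite 2 L, torusSupNorm (klpeP L k - (perturbedFermiRadius (fun k : Fin 2 → ℝ => frameShift (klFlowFrameU L M β U μ n) (WithLp.toLp 2 k)) μ θ * Real.cos θ, perturbedFermiRadius (fun k : Fin 2 → ℝ => frameShift (klFlowFrameU L M β U μ n) (WithLp.toLp 2 k)) μ θ * Real.sin θ)) ≤ r → k ∈ S i) ∧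
              (∀ θ ∈ Ioo (-π) π, ∃ i, θ ∈ Icc (αc i) (βc i)) ∧
              (∀ t ∈ Icc (0 : ℝ) 1, ∀ i, ∀ k ∈ S i, ∀ k' ∈ S i, ‖(∑ σ : Fin 2, V j t ![(((omega0 M, k), σ), 1), (((omega0 M, k + (x - y)), σ), 0), (((omega0 M, y), 0), 0), (((omega0 M, x), 0), 1)] * V j t ![(((omega0 M, k), σ), 0), (((omega0 M, k + (x - y)), σ), 1), ((((omega0 M).rev, Qm - y), 1), 0), ((((omega0 M).rev, Qm - x), 1), 1)]) - ∑ σ : Fin 2, V j t ![(((omega0 M, k'), σ), 1), (((omega0 M, k' + (x - y)), σ), 0), (((omega0 M, y), 0), 0), (((omega0 M, x), 0), 1)] * V j t ![(((omega0 M, k'), σ), 0), (((omega0 M, k' + (x - y)), σ), 1), ((((omega0 M).rev, Qm - y), 1), 0), ((((omega0 M).rev, Qm - x), 1), 1)]‖ ≤ Lc i * klTorusNorm L (k - k')) ∧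
              (∀ t ∈ Icc (0 : ℝ) 1, ∀ i, ∀ k ∈ S i, ∀ k' ∈ S i, ‖(∑ σ : Fin 2, V j t ![(((omega0 M, k + -(x - y)), σ), 1), (((omega0 M, k), σ), 0), (((omega0 M, y), 0), 0), (((omega0 M, x), 0), 1)] * V j t ![(((omega0 M, k + -(x - y)), σ), 0), (((omega0 M, k), σ), 1), ((((omega0 M).rev, Qm - y), 1), 0), ((((omega0 M).rev, Qm - x), 1), 1)]) - ∑ σ : Fin 2, V j t ![(((omega0 M, k' + -(x - y)), σ), 1), (((omega0 M, k'), σ), 0), (((omega0 M, y), 0), 0), (((omega0 M, x), 0), 1)] * V j t ![(((omega0 M, k' + -(x - y)), σ), 0), (((omega0 M, k'), σ), 1), ((((omega0 M).rev, Qm - y), 1), 0), ((((omega0 M).rev, Qm - x), 1), 1)]‖ ≤ Lc i * klTorusNorm L (k - k')) ∧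
              (∀ t ∈ Icc (0 : ℝ) 1, ∀ i, ∀ k ∈ S i, ∀ k' ∈ S i, ‖V j t ![(((omega0 M, k), 0), 1), ((((omega0 M).rev, k + (Qm - x - y)), 1), 0), (((omega0 M, y), 0), 0), ((((omega0 M).rev, Qm - x), 1), 1)] * V j t ![(((omega0 M, k), 0), 0), ((((omega0 M).rev, k + (Qm - x - y)), 1), 1), ((((omega0 M).rev, Qm - y), 1), 0), (((omega0 M, x), 0), 1)] - V j t ![(((omega0 M, k'), 0), 1), ((((omega0 M).rev, k' + (Qm - x - y)), 1), 0), (((omega0 M, y), 0), 0), ((((omega0 M).rev, Qm - x), 1), 1)] * V j t ![(((omega0 M, k'), 0), 0), ((((omega0 M).rev, k' + (Qm - x - y)), 1), 1), ((((omega0 M).rev, Qm - y), 1), 0), (((omega0 M, x), 0), 1)]‖ ≤ Lc i * klTorusNorm L (k - k')) ∧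
              (∀ t ∈ Icc (0 : ℝ) 1, ∀ i, ∀ k ∈ S i, ∀ k' ∈ S i, ‖V j t ![(((omega0 M, k + -(Qm - x - y)), 0), 1), ((((omega0 M).rev, k), 1), 0), (((omega0 M, y), 0), 0), ((((omega0 M).rev, Qm - x), 1), 1)] * V j t ![(((omega0 M, k + -(Qm - x - y)), 0), 0), ((((omega0 M).rev, k), 1), 1), ((((omega0 M).rev, Qm - y), 1), 0), (((omega0 M, x), 0), 1)] - V j t ![(((omega0 M, k' + -(Qm - x - y)), 0), 1), ((((omega0 M).rev, k'), 1), 0), (((omega0 M, y), 0), 0), ((((omega0 M).rev, Qm - x), 1), 1)] * V j t ![(((omega0 M, k' + -(Qm - x - y)), 0), 0), ((((omega0 M).rev, k'), 1), 1), ((((omega0 M).rev, Qm - y), 1), 0), (((omega0 M, x), 0), 1)]‖ ≤ Lc i * klTorusNorm L (k - k')) ∧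
              (∀ w, 0 ≤ ρw w) ∧
              (∀ w, 0 ≤ A₂ w) ∧
              (∀ t ∈ Icc (0 : ℝ) 1, ∀ (w : Fin Nw) (i : MatsubaraIdx M) (σ : Fin 2) (k k' : TorusSite 2 L), matsubaraFreq β M i ^ 2 ≤ (4 * klScale klE0 (n + 1)) ^ 2 → klTorusNorm L (k - cen w) ≤ ρw w → ‖V j t ![(((i, k), σ), 1), (((i, k'), σ), 0), (((omega0 M, y), 0), 0), (((omega0 M, x), 0), 1)] * V j t ![(((i, k), σ), 0), (((i, k'), σ), 1), ((((omega0 M).rev, Qm - y), 1), 0), ((((omega0 M).rev, Qm - x), 1), 1)] - V j t ![(((omega0 M, k), σ), 1), (((omega0 M, k'), σ), 0), (((omega0 M, y), 0), 0), (((omega0 M, x), 0), 1)] * V j t ![(((omega0 M, k), σ), 0), (((omega0 M, k'), σ), 1), ((((omega0 M).rev, Qm - y), 1), 0), ((((omega0 M).rev, Qm - x), 1), 1)]‖ ≤ A₂ w) ∧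
              (∀ t ∈ Icc (0 : ℝ) 1, ∀ (w : Fin Nw) (i i' : MatsubaraIdx M) (k k' : TorusSite 2 L), matsubaraInt M i' + 1 = matsubaraInt M i → matsubaraFreq β M i ^ 2 ≤ (5 * klScale klE0 (n + 1)) ^ 2 → klTorusNorm L (k - cenx w) ≤ ρw w → ‖V j t ![(((i, k), 0), 1), (((i', k'), 1), 0), (((omega0 M, y), 0), 0), ((((omega0 M).rev, Qm - x), 1), 1)] * V j t ![(((i, k), 0), 0), (((i', k'), 1), 1), ((((omega0 M).rev, Qm - y), 1), 0), (((omega0 M, x), 0), 1)] - V j t ![(((omega0 M, k), 0), 1), ((((omega0 M).rev, k'), 1), 0), (((omega0 M, y), 0), 0), ((((omega0 M).rev, Qm - x), 1), 1)] * V j t ![(((omega0 M, k), 0), 0), ((((omega0 M).rev, k'), 1), 1), ((((omega0 M).rev, Qm - y), 1), 0), (((omega0 M, x), 0), 1)]‖ ≤ A₂ w) ∧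
              (0 ≤ A₀S) ∧
              (0 ≤ LAS) ∧
              (0 ≤ εS) ∧
              (∀ t ∈ Icc (0 : ℝ) 1, ∀ k : TorusSite 2 L, ‖∑ σ : Fin 2, V6 j t ![(((omega0 M, k), σ), 0), (((omega0 M, k), σ), 1), (((omega0 M, y), 0), 0), ((((omega0 M).rev, Qm - y), 1), 0), ((((omega0 M).rev, Qm - x), 1), 1), (((omega0 M, x), 0), 1)] * Sg j t (omega0 M, k) σ‖ ≤ A₀S) ∧
              (∀ t ∈ Icc (0 : ℝ) 1, ∀ k k' : TorusSite 2 L, ‖(∑ σ : Fin 2, V6 j t ![(((omega0 M, k), σ), 0), (((omega0 M, k), σ), 1), (((omega0 M, y), 0), 0), ((((omega0 M).rev, Qm - y), 1), 0), ((((omega0 M).rev, Qm - x), 1), 1), (((omega0 M, x), 0), 1)] * Sg j t (omega0 M, k) σ) - ∑ σ : Fin 2, V6 j t ![(((omega0 M,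
                  k'), σ), 0), (((omega0 M, k'), σ), 1), (((omega0 M, y), 0), 0), ((((omega0 M).rev, Qm - y), 1), 0), ((((omega0 M).rev, Qm - x), 1), 1), (((omega0 M, x), 0), 1)] * Sg j t (omega0 M, k') σ‖ ≤ LAS * klTorusNorm L (k - k')) ∧
              (∀ t ∈ Icc (0 : ℝ) 1, ∀ (i : MatsubaraIdx M) (σ : Fin 2) (k : TorusSite 2 L), matsubaraFreq β M i ^ 2 ≤ (4 * klScale klE0 (n + 1)) ^ 2 → ‖V6 j t ![(((i, k), σ), 0), (((i, k), σ), 1), (((omega0 M, y), 0), 0), ((((omega0 M).rev, Qm - y), 1), 0), ((((omega0 M).rev, Qm - x), 1), 1), (((omega0 M, x), 0), 1)]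
                  * Sg j t (i, k) σ - V6 j t ![(((omega0 M, k), σ), 0), (((omega0 M, k), σ), 1), (((omega0 M, y), 0), 0), ((((omega0 M).rev, Qm - y), 1), 0), ((((omega0 M).rev, Qm - x), 1), 1), (((omega0 M, x), 0), 1)] * Sg j t (omega0 M, k) σ‖ ≤ εS) ∧
              (A₁ ≤ 2 ^ 10 * (P.Klam * U) ^ 2) ∧
              ((∑ i, Lc i * (βc i - αc i)) ≤ 2 ^ 35 * (P.Klam * U) ^ 2) ∧
              ((β ^ 2 + 1) * (2 ^ 18 * (Kg + LAS / 2) + 2 ^ 30 * (A₁ + A₀S / 2) * (4 + 8 / 3 * R.Gfr 1 * U ^ 2) * (16 : ℝ) ^ (j - (n + 1))) ≤ 4⁻¹ * (klEngQ9dG klEngGeo14 P R).CL β n) ∧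
              (A₀S ≤ 2 ^ 24 * (P.Klam * U) ^ 3) ∧
              (LAS ≤ 2 ^ 24 * (P.Klam * U) ^ 3) ∧
              ((klScale klE0 n - klScale klE0 (n + 1)) * (2⁻¹ * RH) ≤ 4⁻¹ * (klEngGeo11.cloc * (P.Klam * U) ^ 2 * (4 : ℝ) ^ (-(klEngGeo11.θ * n)))) ∧
              (2 * (3 / π * (128 / Real.pi * 8 * (Real.pi * Real.sqrt 2 / (cDtmin (-(6 / 5)) (-(1 / 10)) - 4 * (2 * R.Gfr 0 * |U| + 2 * R.Gfr 1 * U ^ 2 + R.Gfr 2 * (c / Real.log 4)))) * ((∑ i, (2 * Lc i + 4 * Kg) * (Real.pi / L) * (βc i - αc i)) / (2 * π)))) ≤ 4⁻¹ * ((klEngQ9dG klEngGeo14 P R).CL β n / L)) ∧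
              (2 * (ε₁ * (2048 * 15367) + ∑ w, A₂ w * (4096 * 15381) * (ρw w / π + ((L : ℝ))⁻¹)) + 2 * (εS * (2048 * 15367)) + ((2 : ℝ) ^ 10 * 15367 * ε₁ + ∑ w, (2 : ℝ) ^ 10 * 15381 * (ρw w / π + ((L : ℝ))⁻¹) * A₂ w) ≤ 4⁻¹ * (klEngGeo11.cloc * (P.Klam * U) ^ 2 * (4 : ℝ) ^ (-(klEngGeo11.θ * n))) + 4⁻¹ * ((klEngQ9dG klEngGeo14 P R).CR * (P.Klam * |U|) ^ 3 * ((2 : ℝ) ^ n)⁻¹)) ∧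
              (¬ IsPairClassAt L Qm n → ∃ N : Matrix (TorusSite 2 L) (TorusSite 2 L) ℂ, (1 - diagonal (fun p => ((klTransferWeight L M β μ (klFlowFrameU L M β U μ n) n (softSymbolCompl L M β μ (klFlowFrameU L M β U μ n) n (n + 1)) Qm p - klTransferWeight L M β μ (klFlowFrameU L M β U μ n) n (softSymbolCompl L M β μ
                  (klFlowFrameU L M β U μ n) n n) Qm p : ℝ) : ℂ)) * klMemberArrayF L M β U μ n (softSymbolCompl L M β μ (klFlowFrameU L M β U μ n) n n) Qm) * N = 1 ∧ N * (1 - diagonal (fun p => ((klTransferWeight L M β μ (klFlowFrameU L M β U μ n) n (softSymbolCompl L M β μ (klFlowFrameU L M β U μ n) n (n + 1)) Qm p -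
                  klTransferWeight L M β μ (klFlowFrameU L M β U μ n) n (softSymbolCompl L M β μ (klFlowFrameU L M β U μ n) n n) Qm p : ℝ) : ℂ)) * klMemberArrayF L M β U μ n (softSymbolCompl L M β μ (klFlowFrameU L M β U μ n) n n) Qm) = 1 ∧ ∀ k ∈ klBall L μ 0, ∀ k' ∈ klBall L μ 0, ‖klMemberArrayF L M β U μ n
                  (softSymbolCompl L M β μ (klFlowFrameU L M β U μ n) n (n + 1)) Qm k k' - (klMemberArrayF L M β U μ n (softSymbolCompl L M β μ (klFlowFrameU L M β U μ n) n n) Qm * N) k k'‖ ≤ (transferBarRelIdx L klEngGeoTh P (klCT8 P R (klEngQ7 P R) klEngGeo14 klEngGeoTh) β U n n) Qm k k') ∧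
              ((n + 1 ≤ nScales β → ∀ (s₀ s₁ : FreqMomentum L M × Fin 2 → ℂ), (s₀ = uvSymbolCT L M β μ (klFlowFrameU L M β U μ n) (klScale klE0 (n + 1))) → (s₁ = fun ks => uvSymbolCT L M β μ (klFlowFrameU L M β U μ (n + 1)) (klScale klE0 (n + 1)) ks / (1 + uvSymbolCT L M β μ (klFlowFrameU L M β U μ (n + 1)) (klScale
                  klE0 (n + 1)) ks * (((fsub (klFlowFrameU L M β U μ (n + 1)) (klFlowFrameU L M β U μ n)).eval (latticeMomentum L ks.1.2) / (β * (L : ℝ) ^ 2) : ℝ) : ℂ))) → ∃ (a n₆ s₂ n₄ : ℝ), (effPartitionFn ℂ (normalCovariance L M (uvSymbolCT L M β μ (klFlowFrameU L M β U μ (n + 1)) (klScale klE0 (n + 1))))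
                  (hubbardInteraction L M β U + counterQuadratic L M β (klFlowFrameU L M β U μ (n + 1))) ≠ 0) ∧ (∀ t ∈ Set.Icc (0 : ℝ) 1, effPartitionFn ℂ (normalCovariance L M s₀ + ((t : ℂ)) • (normalCovariance L M s₁ - normalCovariance L M s₀)) (hubbardInteraction L M β U + counterQuadratic L M β (klFlowFrameU L M β
                  U μ n)) ≠ 0) ∧ 0 ≤ a ∧ a ≤ 2 ^ 28 ∧ 0 ≤ n₆ ∧ 0 ≤ s₂ ∧ 0 ≤ n₄ ∧ (547400 * (8 / Real.pi * 2946 * n₆ + 4 * s₂ * n₄) ≤ klHshiftC) ∧ (‖klPairAmplitude L M β U μ (klFlowFrameU L M β U μ (n + 1)) (n + 1) Qm x y‖ ≤ a * (P.Klam * |U|)) ∧ (∀ t ∈ Set.Icc (0 : ℝ) 1, ∀ A : HubbardFieldIdx L M, ‖kernel ℂ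
                  (effAction ℂ (normalCovariance L M s₀ + ((t : ℂ)) • (normalCovariance L M s₁ - normalCovariance L M s₀)) (hubbardInteraction L M β U + counterQuadratic L M β (klFlowFrameU L M β U μ n))) 6 (Fin.snoc (Fin.snoc ![(((omega0 M, y), 0), 0), ((((omega0 M).rev, Qm - y), 1), 0), ((((omega0 M).rev, Qm - x),
                  1), 1), (((omega0 M, x), 0), 1)] (A.1, 1 - A.2) : Fin 5 → HubbardFieldIdx L M) A)‖ ≤ n₆ * (P.Klam * U) ^ 2 / klScale klE0 (n + 1) / (720 * (β * (L : ℝ) ^ 2) ^ 5)) ∧ (∀ t ∈ Set.Icc (0 : ℝ) 1, ∀ i : Fin 4, |nambuXiCT L μ (klFlowFrameU L M β U μ n) ((![(((omega0 M, y), 0), 0), ((((omega0 M).rev, Qm -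
                  y), 1), 0), ((((omega0 M).rev, Qm - x), 1), 1), (((omega0 M, x), 0), 1)] : Fin 4 → HubbardFieldIdx L M) i).1.1.2| < 5 * klScale klE0 (n + 1) / 4 → ‖kernel ℂ (effAction ℂ (normalCovariance L M s₀ + ((t : ℂ)) • (normalCovariance L M s₁ - normalCovariance L M s₀)) (hubbardInteraction L M β U +
                  counterQuadratic L M β (klFlowFrameU L M β U μ n))) 2 ![((((![(((omega0 M, y), 0), 0), ((((omega0 M).rev, Qm - y), 1), 0), ((((omega0 M).rev, Qm - x), 1), 1), (((omega0 M, x), 0), 1)] : Fin 4 → HubbardFieldIdx L M) i).1, 1 - ((![(((omega0 M, y), 0), 0), ((((omega0 M).rev, Qm - y), 1), 0), ((((omega0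
                  M).rev, Qm - x), 1), 1), (((omega0 M, x), 0), 1)] : Fin 4 → HubbardFieldIdx L M) i).2) : HubbardFieldIdx L M), (![(((omega0 M, y), 0), 0), ((((omega0 M).rev, Qm - y), 1), 0), ((((omega0 M).rev, Qm - x), 1), 1), (((omega0 M, x), 0), 1)] : Fin 4 → HubbardFieldIdx L M) i]‖ ≤ s₂ * |U| * klScale klE0 (n +
                  1) / (2 * (β * (L : ℝ) ^ 2))) ∧ (∀ t ∈ Set.Icc (0 : ℝ) 1, ‖kernel ℂ (effAction ℂ (normalCovariance L M s₀ + ((t : ℂ)) • (normalCovariance L M s₁ - normalCovariance L M s₀)) (hubbardInteraction L M β U + counterQuadratic L M β (klFlowFrameU L M β U μ n))) 4 ![(((omega0 M, y), 0), 0), ((((omega0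
                  M).rev, Qm - y), 1), 0), ((((omega0 M).rev, Qm - x), 1), 1), (((omega0 M, x), 0), 1)]‖ ≤ n₄ * (P.Klam * |U|) / (24 * (β * (L : ℝ) ^ 2) ^ 3))) ∧ (n = nScales β → ∃ a : ℝ, (IsUnit (effPartitionFn ℂ (normalCovariance L M (uvSymbolCT L M β μ (klFlowFrameU L M β U μ (n + 1)) (klScale klE0 (n + 1))))
                  (hubbardInteraction L M β U + counterQuadratic L M β (klFlowFrameU L M β U μ (n + 1))))) ∧ 0 ≤ a ∧ a ≤ 2 ^ 28 ∧ (‖klPairAmplitude L M β U μ (klFlowFrameU L M β U μ (n + 1)) (n + 1) Qm x y‖ ≤ a * (P.Klam * |U|))))) :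
    ∀ (P : SplitConsts) (R : RenConsts) (c : ℝ), P.WF → R.WF2 → 0 < c → c ≤ klEngC₃7GU klEngGeo14 P R →
      ∀ μ ∈ klWindowC, ∀ U : ℝ, 0 < U → U ≤ klEngU₀12GQ klEngGeo14 (klEngQ9dG klEngGeo14 P R) P R c → ∀ β : ℝ, klBetaMin ≤ β → β ≤ Real.exp (c / U ^ 2) →
        ∀ (L M : ℕ) [NeZero L] [NeZero M], klEngL₄ P R β U ≤ L → klEngM₃ β U L ≤ M →
          ∀ n : ℕ, 1 ≤ n → n ≤ nScales β + 1 → IsKLRegime U c (-(n : ℤ)) →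
            HistP klPredsV17F2 L M klEngGeo14 P (klEngQ9dG klEngGeo14 P R) R β U μ 0 n →
              FrameOK R U (nScales β) μ (klFlowFrameU L M β U μ n) →
                KernelNormsV4 L M P (klEngQ9dG klEngGeo14 P R) β U μ (klFlowFrameU L M β U μ n) n →
                  (∀ j ≤ n, (KernelNormsLevels L M P (klEngQ9dG klEngGeo14 P R) β U μ (klFlowFrameU L M β U μ n) j ∧
                    KernelNormsWt4 L M (klWtBudget P (klEngQ9dG klEngGeo14 P R) U j) β U μ (klFlowFrameU L M β U μ n) j)) →
                    (∀ j ≤ n, LevelsUExportMixedAt L M (klCU2 P R (klEngQ7 P R)) P β U μ j) →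
                      (∀ j ≤ n, IsoTupleLineBAt L M klE5AM klE5cM (klE5dM P R) P β U μ j) →
                        (∀ j ≤ n, PairTransferRelFamilyK5 L M klEngGeoTh P (klCT8 P R (klEngQ7 P R) klEngGeo14 klEngGeoTh) β U μ j) →
                  PairLadderStepAtV17F2 L M klEngGeo14 P (klEngQ9dG klEngGeo14 P R) β U μ n ∧
                    PairValueIncrementAtV17F L M klEngGeo14 P (klEngQ9dG klEngGeo14 P R) β U μ n ∧
                      QuarticValueIncrementAtV17F L M klEngGeo14 P (klEngQ9dG klEngGeo14 P R) β U μ n ∧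
                        IsoTupleL1AtV17F L M klEngGeo14 P β U μ n :=
  stub_engine_step_values_of_producers_pkg₁₀ (rowC_hexLadPkg_of_towerGrid hexLadG) hexOutPkg

end Summit.HubbardSuperconductivity.HubbardSuperconductivity.Theorems.EngineV8.A24a1G14

end
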